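import Mathlib
import HarnessLib
import Summits.HubbardSuperconductivity.HubbardSuperconductivity.Theorems.KLProgrammeFermiSurfaceWindow
import Summits.HubbardSuperconductivity.HubbardSuperconductivity.Theorems.KLProgrammeFermiSurfaceFST2Constants
import Summits.HubbardSuperconductivity.HubbardSuperconductivity.Theorems.KLProgrammeFermiSurfaceFST2Global
import Summits.HubbardSuperconductivity.HubbardSuperconductivity.Theorems.KLProgrammeFermiSurfaceFST3
import Summits.HubbardSuperconductivity.HubbardSuperconductivity.Theorems.KLProgrammeFermiSurfaceFSTInversion
import Summits.HubbardSuperconductivity.HubbardSuperconductivity.Theorems.KLProgrammeFermiSurfaceSalmhofer1998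
import Summits.HubbardSuperconductivity.HubbardSuperconductivity.Theorems.KLProgrammeFermiSurfaceBGM2003Lattice
import Summits.HubbardSuperconductivity.HubbardSuperconductivity.Theorems.KLProgrammeFermiSurfaceBGM2003SectorCounting
import Summits.HubbardSuperconductivity.HubbardSuperconductivity.Theorems.KLProgrammeFermiSurfaceBGM2006
import Summits.HubbardSuperconductivity.HubbardSuperconductivity.Theorems.KLProgrammeFermiSurfaceFKTOverview
import Summits.HubbardSuperconductivity.HubbardSuperconductivity.Theorems.KLProgrammeFermiSurfaceCornerTransversal
import Summits.HubbardSuperconductivity.HubbardSuperconductivity.Theorems.KLProgrammeFermiSurfaceTwoLoopVolume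

/-!
# Route `KLProgramme` / `WeakCouplingBCS` — risk-register item r2: the Fermi-surface rows on the EXTENDED certificate window
# `μ ∈ [-0.5725, -0.075]` (cert-2's `δ ∈ [0.05, 0.25]`: WinZ `[-0.5725, -0.42749]` ∪ WinA–C ∪ WinD `[-0.1775, -0.075]`)

Cell `gate-hubbard-kl`, seat fs-1 (g6). The certificate half is being extended from `δ ∈ [0.10, 0.20]` to `δ ∈ [0.05, 0.25]`
(seat hubbard-kl-cert-2: 50 μ-boxes spanning `μ ∈ [-0.5725, -0.075] ∋ μ(0.25) = -0.56821, μ(0.05) = -0.07813`; WinZ record p457688).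
This file is the `[-0.5725, -0.075]` edition of `KLProgrammeFermiSurfaceDopingWindow.lean`: every numeric fs-1 row restated on the
extended window (which contains the doping window of record `[-0.4275, -0.1775]`, WinZ and WinD: `klfs_xwin_of_sub`), so that a
`δ ∈ [0.05, 0.25]` form follows by one line from a filling certificate `μ([0.05, 0.25]) ⊂ [-0.5725, -0.075]` (margin-2's generator,
cert-3's item (4)) exactly as `KLProgrammeFermiSurfaceDopingForm.lean` does on `[0.10, 0.20]`. The right end `μ = -0.075` is 2.4× closer
to the van Hove level than `-0.1775`: the curvature floor halves and `C_g` grows 5.7× (companion `…ExtWindowSharp.lean`).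

Rows (all for every `μ ∈ [-0.5725, -0.075]`; certified values at the binding end `μ = -0.075`, kit j257184, two interval
implementations — FS-WINDOW.md §9):
* §1 speed / curvature / nesting: `v_F = ‖∇ε‖ ≥ 0.5425` (true `0.54256`), `0.0132 ≤ κ ≤ 3.69` (true `0.013261 … 3.6862`),
  `Q = (π,π)` nesting defect `≥ 0.15`, `∇ε ≠ 0`;
* §2 umklapp: `¬(A5)`, the `(1,0)` umklapp quadruple, the `(1,0)`-corner with transversality factor `m·s ≥ 0.0428`
  (true minimum `0.043294` at `μ = -0.075`);
* §3 the typed hypothesis sets: FST II `GeomConstants e 4.5725 0.0375 0.381 0.0187` and (A1)–(A4), (Sy), (A3) global; FST III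
  `Admits M ⟨0, 42, normV, 0.38, 0.0375, 0.0187⟩ + (H1)–(H4), `¬(H5)`; FST IV `¬InDispersionClass` (every cell); Salmhofer 1998
  `ModelData.Hyp`; BGM 2003 `DispersionHyp` / `LatticeModelHyp` / Lemma 3.1 sector counting with `e₀ = 0.05`; BGM 2006 Lemma 2.1
  clause (3) fails at `h = 0`; FKT 2004 `¬Hypotheses`; FST II Thm 1.1 (ONE `Q` for the whole extended window);
* (companion `KLProgrammeFermiSurfaceExtWindowSharp.lean`: `∂ₜF ≥ 0.5424` and the SHARP `BandBounds (-0.5725) (-0.075)` bundle with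
  Lean-certified numbers, `C_g ≤ 556`.)

No definitions; everything PROVED (compositions of the lineage's closed forms with rational arithmetic). [folklore]
-/
noncomputable section

open Real Set

-- the tree's namespace `Summit.<Summit>.<Problem>.Theorems` repeats the summit name by design (D-0017)
set_option linter.dupNamespace false

namespace Summit.HubbardSuperconductivity.HubbardSuperconductivity.Theorems

open Literature.MathematicalPhysics.QuantumLattice
open Literature.MathematicalPhysics.QuantumLattice.BandSectorCounting

/-! ### §0 The window -/

/-- The extended window `μ ∈ [-0.5725, -0.075]` lies in `(-2, 0)` (so `-4 < μ`, `-8/3 < μ`, `-2 ≤ μ`). [folklore] -/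
theorem klfs_xwin_sub {μ : ℝ} (hμ : μ ∈ Icc (-0.5725 : ℝ) (-0.075)) : -2 < μ ∧ μ < 0 :=
  ⟨by linarith [hμ.1], by linarith [hμ.2]⟩

/-- The doping window of record `[-0.4275, -0.1775]`, cert-2's WinZ `[-0.5725, -0.42749]` and WinD `[-0.1775, -0.075]` all lie in
the extended window `[-0.5725, -0.075]`. [folklore] -/
theorem klfs_xwin_of_sub {μ : ℝ}
    (hμ : μ ∈ Icc (-0.4275 : ℝ) (-0.1775) ∨ μ ∈ Icc (-0.5725 : ℝ) (-0.42749) ∨ μ ∈ Icc (-0.1775 : ℝ) (-0.075)) :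
    μ ∈ Icc (-0.5725 : ℝ) (-0.075) := by
  rcases hμ with h | h | h
  · exact ⟨by linarith [h.1], by linarith [h.2]⟩
  · exact ⟨h.1, by linarith [h.2]⟩
  · exact ⟨by linarith [h.1], h.2⟩

/-! ### §1 Speed, curvature, nesting -/

/-- **`v_F ≥ 0.5425` on the extended window**: for `μ ∈ [-0.5725, -0.075]` and any point of the level curve,
`2 √(sin² x + sin² y) ≥ 0.5425` (true minimum `√(0.075 · 3.925) = 0.54256…` at the antinode of `μ = -0.075`). [folklore] -/
theorem klfs_xwin_fermiSpeed_ge {μ x y : ℝ} (hμ : μ ∈ Icc (-0.5725 : ℝ) (-0.075))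
    (h : -2 * (Real.cos x + Real.cos y) = μ) : 0.5425 ≤ 2 * Real.sqrt (Real.sin x ^ 2 + Real.sin y ^ 2) := by
  have hI := (klfs_fermiSpeedSq_mem_Icc h).1
  have hμ2 : (0.5425 : ℝ) ^ 2 ≤ -μ * (4 + μ) := by
    nlinarith [mul_nonpos_iff.2 (Or.inl ⟨sub_nonneg.2 hμ.1, sub_nonpos.2 hμ.2⟩), hμ.1, hμ.2]
  rw [klfs_two_mul_sqrt]
  exact Real.le_sqrt_of_sq_le (hμ2.trans hI)

/-- The same in `KohnLuttinger` vocabulary: `‖∇ε(k)‖ ≥ 0.5425` on the Fermi curve, `μ` in the extended window. [folklore] -/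
theorem klfs_xwin_norm_gradient_ge {μ : ℝ} (hμ : μ ∈ Icc (-0.5725 : ℝ) (-0.075)) {k : Momentum}
    (hk : k ∈ fermiCurve (squareDispersion 1 0) μ) : 0.5425 ≤ ‖gradient (squareDispersion 1 0) k‖ := by
  have he : -2 * (Real.cos (k 0) + Real.cos (k 1)) = μ := by
    have := hk.2; simp [squareDispersion] at this; linarith
  rw [norm_gradient_squareDispersion]
  exact klfs_xwin_fermiSpeed_ge hμ he

/-- `∇ε ≠ 0` on the Fermi curve, `μ` in the extended window (FST II (A2)). [folklore] -/
theorem klfs_xwin_gradient_ne_zero {μ : ℝ} (hμ : μ ∈ Icc (-0.5725 : ℝ) (-0.075)) {k : Momentum}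
    (hk : k ∈ fermiCurve (squareDispersion 1 0) μ) : gradient (squareDispersion 1 0) k ≠ 0 :=
  klfs_gradient_ne_zero (by linarith [hμ.1]) (by linarith [hμ.2]) hk

/-- **`0.0132 ≤ κ ≤ 3.69` on the extended window** (true extremes `0.013261` at the node of `μ = -0.075` and `3.6862` at its
antinode). [folklore] -/
theorem klfs_xwin_curvature {μ x y : ℝ} (hμ : μ ∈ Icc (-0.5725 : ℝ) (-0.075))
    (h : -2 * (Real.cos x + Real.cos y) = μ) :
    (Real.cos x * Real.sin y ^ 2 + Real.cos y * Real.sin x ^ 2) /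
        ((Real.sin x ^ 2 + Real.sin y ^ 2) * Real.sqrt (Real.sin x ^ 2 + Real.sin y ^ 2)) ∈
      Icc (0.0132 : ℝ) 3.69 := by
  obtain ⟨hμ₁, hμ₂⟩ := klfs_xwin_sub hμ
  have hI := klfs_curvature_mem_Icc (by linarith) hμ₂ h
  constructor
  · refine le_trans ?_ hI.1
    have hs : Real.sqrt (32 - 2 * μ ^ 2) ≤ 5.66 := by
      rw [Real.sqrt_le_left (by norm_num)]; nlinarith
    have hspos : 0 < Real.sqrt (32 - 2 * μ ^ 2) := Real.sqrt_pos.2 (by nlinarith)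
    rw [le_div_iff₀ hspos]
    nlinarith [hμ.2]
  · refine le_trans hI.2 ?_
    have hs : (0.5425 : ℝ) ≤ Real.sqrt (-μ * (4 + μ)) := by
      apply Real.le_sqrt_of_sq_le
      nlinarith [mul_nonpos_iff.2 (Or.inl ⟨sub_nonneg.2 hμ.1, sub_nonpos.2 hμ.2⟩), hμ.1, hμ.2]
    rw [div_le_iff₀ (by linarith)]
    nlinarith

/-- **Nesting defect `≥ 0.15` on the extended window** (`|ε(k + (π,π)) - μ| = 2|μ|`). [folklore] -/
theorem klfs_xwin_nesting_defect {μ : ℝ} (hμ : μ ∈ Icc (-0.5725 : ℝ) (-0.075)) {k : Fin 2 → ℝ}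
    (hk : sqDispersion k = μ) : 0.15 ≤ |sqDispersion (fun i => k i + π) - μ| := by
  rw [klfs_nesting_defect hk, abs_of_neg (by linarith [hμ.2])]
  linarith [hμ.2]

/-! ### §2 Umklapp on the extended window: (A5) fails, the quadruple, the corner -/

/-- **Umklapp geometry on the extended window** (all of it lies in `[-2, 0)`): FST II's (A5) FAILS (`klfs_not_hypA5`),
there is a four-leg umklapp configuration on the Fermi curve with `G = (1,0)` (`klfs_exists_umklapp_quadruple`), a pair
of curve points with `p + q ∉` Brillouin zone (`klfs_not_A5_momentum`), and the `(1,0)`-corner `3p(θ*) ∈ F + 2π(1,0)`,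
`0 < θ* < π/4` (`klfs_exists_corner`) — so DECOMP's «A5 fails on the window ⇒ C4b is load-bearing» holds on the whole
extended window. [folklore] -/
theorem klfs_xwin_umklapp {μ : ℝ} (hμ : μ ∈ Icc (-0.5725 : ℝ) (-0.075)) :
    ¬ FermiRG.HypA5 (FermiRG.Crystal.cubic 2) (fun q : Momentum => squareDispersion 1 0 q - μ) ∧
    (∃ k : Fin 4 → Fin 2 → ℝ, (∀ j i, |k j i| < π) ∧ (∀ j, sqDispersion (k j) = μ) ∧
      (![(1 : ℤ), 0] : Fin 2 → ℤ) ≠ 0 ∧ ∀ i, ∑ j, k j i = 2 * π * ((![(1 : ℤ), 0] : Fin 2 → ℤ) i : ℝ)) ∧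
    (∃ p q : Momentum, p ∈ fermiCurve (squareDispersion 1 0) μ ∧ q ∈ fermiCurve (squareDispersion 1 0) μ ∧
      p + q ∉ brillouinZone) ∧
    (∃ θ ∈ Ioo (0 : ℝ) (π / 4), rayDispersion (θ, 3 * bandFermiRadius μ θ) = μ ∧
      π < ‖(3 * bandFermiRadius μ θ) • dir θ‖) := by
  obtain ⟨hμ₁, hμ₂⟩ := klfs_xwin_sub hμ
  exact ⟨klfs_not_hypA5 hμ₁.le hμ₂, klfs_exists_umklapp_quadruple hμ₁.le hμ₂, klfs_not_A5_momentum hμ₁.le hμ₂,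
    klfs_exists_corner (by linarith) hμ₂ hμ₁⟩

/-- **Quantitative corner transversality on the extended window**: at the `(1,0)`-corner, `sin²x₁ - sin²y₁ = m·s ≥ 0.0428`
(`m = -μ/2 ≥ 0.0375` and `s = √((4 - m²)/3) ≥ 1.142` bounded separately; true minimum `0.043294` at `μ = -0.075`). [folklore] -/
theorem klfs_xwin_corner_transversality_factor_ge {μ : ℝ} (hμ : μ ∈ Icc (-0.5725 : ℝ) (-0.075)) {θ : ℝ}
    (hθ : θ ∈ Ioo (0 : ℝ) (π / 4)) (hcorner : rayDispersion (θ, 3 * bandFermiRadius μ θ) = μ) :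
    (0.0428 : ℝ) ≤ Real.sin (bandX μ θ) ^ 2 - Real.sin (bandY μ θ) ^ 2 := by
  obtain ⟨hμ₁, hμ₂⟩ := klfs_xwin_sub hμ
  rw [klfs_corner_transversality_factor (by linarith) hμ₂ hθ hcorner]
  have hs : (1.142 : ℝ) ≤ Real.sqrt ((4 - (-μ / 2) ^ 2) / 3) := by
    refine Real.le_sqrt_of_sq_le ?_
    nlinarith [hμ.1, hμ.2]
  have hm : (0.0375 : ℝ) ≤ -μ / 2 := by linarith [hμ.2]
  nlinarith [mul_nonneg (sub_nonneg.2 hm) (sub_nonneg.2 hs)]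

/-! ### §3 The typed hypothesis sets on the extended window -/

/-- **FST II constants on the extended window**: `|e|₂ ≤ 4.5725`, and on `{|e| < 0.0375}`: `|∇e| ≥ 0.381`,
`(t, e'' t) ≥ 0.0187 |t|²` — `GeomConstants e 4.5725 0.0375 0.381 0.0187` for every `μ ∈ [-0.5725, -0.075]`
(closed form `(4+|μ|, -μ/2, √((-μ/2)(4+3μ/2)), -μ/4)` at the binding end: `4.5725, 0.0375, 0.38181, 0.01875`). [folklore] -/
theorem klfs_xwin_geomConstants {μ : ℝ} (hμ : μ ∈ Icc (-0.5725 : ℝ) (-0.075)) :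
    FermiRG.GeomConstants (fun q : Momentum => squareDispersion 1 0 q - μ) 4.5725 0.0375 0.381 0.0187 where
  r₀_pos := by norm_num
  g₀_pos := by norm_num
  wmin_pos := by norm_num
  norm_iteratedFDeriv_le := fun p j hj => (klfs_norm_iteratedFDeriv_e_le μ p j hj).trans (by
    rw [abs_of_neg (by linarith [hμ.2])]; linarith [hμ.1])
  le_norm_gradient := fun p hp => by
    have hμ₁ : -8 / 3 < μ := by linarith [hμ.1]
    have hμ₂ : μ < 0 := by linarith [hμ.2]
    have hp' : |squareDispersion 1 0 p - μ| < -μ / 2 := hp.trans_le (by linarith [hμ.2])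
    refine le_trans ?_ (klfs_norm_gradient_ge_near hμ₁ hμ₂ hp')
    apply Real.le_sqrt_of_sq_le
    nlinarith [hμ.1, hμ.2]
  le_hessQuad := fun p hp t ht => by
    have hμ₁ : -8 / 3 < μ := by linarith [hμ.1]
    have hμ₂ : μ < 0 := by linarith [hμ.2]
    have hp' : |squareDispersion 1 0 p - μ| < -μ / 2 := hp.trans_le (by linarith [hμ.2])
    refine le_trans ?_ (klfs_hessQuad_ge_near hμ₁ hμ₂ hp' ht)
    exact mul_le_mul_of_nonneg_right (by linarith [hμ.2]) (sq_nonneg _)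

/-- **FST II (A1)–(A4), (Sy), (A3) global at every level of the extended window** (and (A5) fails, §2): the qualitative
hypotheses of FST II consumed by the typed statements, for the Hubbard datum `e = ε - μ`, `v̂ ≡ U`. [folklore] -/
theorem klfs_xwin_fst2_hypotheses {μ : ℝ} (hμ : μ ∈ Icc (-0.5725 : ℝ) (-0.075)) (U : ℝ) (k : ℕ) :
    FermiRG.HypA1 (FermiRG.Crystal.cubic 2) k 0 (fun _ : ℝ × Momentum => (U : ℂ)) ∧
    FermiRG.HypA2 (FermiRG.Crystal.cubic 2) k 0 (fun q : Momentum => squareDispersion 1 0 q - μ) ∧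
    FermiRG.HypA3 (fun q : Momentum => squareDispersion 1 0 q - μ) ∧
    FermiRG.HypA3Global (FermiRG.Crystal.cubic 2) (fun q : Momentum => squareDispersion 1 0 q - μ) ∧
    FermiRG.HypA4 (FermiRG.Crystal.cubic 2) (fun q : Momentum => squareDispersion 1 0 q - μ) ∧
    FermiRG.HypSy (fun p : Momentum => squareDispersion 1 0 p - μ) := by
  obtain ⟨hμ₁, hμ₂⟩ := klfs_xwin_sub hμ
  exact ⟨klfs_hypA1 U k, klfs_hypA2 (by linarith) hμ₂ k, klfs_hypA3 (by linarith) hμ₂,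
    klfs_hypA3Global (by linarith) hμ₂, klfs_hypA4 hμ₂, klfs_hypSy μ⟩

/-- **FST III on the extended window**: ONE regularity datum `Admits M ⟨0, 42, normV, 0.38, 0.0375, 0.0187⟩` for any record
carrying the band and `v̂ ≡ U`, `|U| ≤ normV`; the hypotheses (H1)_{2,0}, (H2)_{2,0}, (H3), (H4) of Theorem 1.2 hold; the
filling clause (H5) of Theorem 1.1 (i) FAILS on the crystal's cell. [folklore] -/
theorem klfs_xwin_fst3 {μ : ℝ} (hμ : μ ∈ Icc (-0.5725 : ℝ) (-0.075)) (M : FermiRG.FST3.Model 2)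
    (he : M.e = fun p : Momentum => squareDispersion 1 0 p - μ) {U : ℝ} (hv : M.vhat = fun _ => (U : ℂ))
    {normV : ℝ} (hV : |U| ≤ normV) :
    FermiRG.FST3.Admits M ⟨0, 42, normV, 0.38, 0.0375, 0.0187⟩ ∧
    (FermiRG.FST3.H1 2 0 M ∧ FermiRG.FST3.H2 2 0 M ∧ FermiRG.FST3.H3 M ∧ FermiRG.FST3.H4 M) ∧
    (M.fund = (FermiRG.Crystal.cubic 2).fundamentalDomain → ¬ FermiRG.FST3.H5 M) := by
  obtain ⟨hμ₁, hμ₂⟩ := klfs_xwin_sub hμ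
  have hG := klfs_xwin_geomConstants hμ
  refine ⟨⟨?_, ?_, by norm_num, by norm_num, by norm_num, fun p hp => ?_, fun p hp t ht => ?_⟩,
    klfs_fst3_theorem12_hypotheses (by linarith) hμ₂ M he hv,
    fun hF => (klfs_fst3_h5_iff (by linarith) hμ₂ M he hF).not.2 (by linarith)⟩
  · rw [he]
    have h := klfs_fst4_ckHolderNormLE μ 2
    refine h.mono ?_
    rw [abs_of_neg (by linarith [hμ.2])]
    norm_num
    linarith [hμ.1]
  · rw [hv]
    exact (klfs_ckHolderNormLE_const 2 0 (U : ℂ)).mono (by rwa [Complex.norm_real, Real.norm_eq_abs])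
  · rw [he] at hp ⊢
    exact lt_of_lt_of_le (by norm_num) (hG.le_norm_gradient p hp)
  · rw [he] at hp ht ⊢
    change (0.0187 : ℝ) * ‖t‖ ^ 2 ≤ FermiRG.hessQuad (fun q : Momentum => squareDispersion 1 0 q - μ) p t
    rw [real_inner_comm] at ht
    exact hG.le_hessQuad p hp t ht

/-- **The classes that EXCLUDE the band on the extended window, and Salmhofer's that admits it**: FST IV's inversion class
`𝓔(δ₀,g₀,G₀,w₀)` fails for EVERY fundamental cell and all constants; BGM 2006 Lemma 2.1: the regime `μ < -2-√2` fails, no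
admissible `e₀`, and clause (3) is false at scale `h = 0` for every initial datum; FKT 2004's `Hypotheses` fail; while
Salmhofer 1998 §2.3 `ModelData.Hyp` HOLDS (any `U`, `k₀ ≥ 2`, `0 < ε₀ ≤ 1`). [folklore] -/
theorem klfs_xwin_classes {μ : ℝ} (hμ : μ ∈ Icc (-0.5725 : ℝ) (-0.075)) :
    (∀ (L : FermiRG.FST4.LatticeData 2), L.latt = ((FermiRG.Crystal.cubic 2).dualLattice : Set Momentum) →
      (∀ z ∈ L.fund, ∀ w ∈ L.fund, z - w ∈ L.latt → z = w) → ∀ δ₀ g₀ G₀ w₀ : ℝ,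
      ¬ FermiRG.FST4.InDispersionClass L δ₀ g₀ G₀ w₀ (fun p : Momentum => squareDispersion 1 0 p - μ)) ∧
    (¬ (μ < -2 - Real.sqrt 2) ∧ ∀ e₀ : ℝ, ¬ FermiRG.BGMAdmissibleE0 μ e₀) ∧
    (∀ {E : ℤ → ℝ × (Fin 2 → ℝ) → ℂ}, FermiRG.BGMInitial E → ∀ β : ℝ,
      ∃ k : Fin (2 * 2) → Fin 2 → ℝ, (∀ j, k j ∈ FermiRG.zoneSq ∧ FermiRG.bgmEffDisp β E 0 (k j) = μ + 0) ∧
        ¬ Real.sqrt ((∑ j, k j 0) ^ 2 + (∑ j, k j 1) ^ 2) < 2 * π) ∧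
    (∀ (D : FermiRG.FKT2004.FermiCurveData), (D.e = fun k : Momentum => squareDispersion 1 0 k - μ) →
      ∀ r : ℕ, ¬ FermiRG.FKT2004.Hypotheses r D) ∧
    (∀ (U : ℝ) {k₀ : ℕ}, 2 ≤ k₀ → ∀ {ε₀ : ℝ}, 0 < ε₀ → ε₀ ≤ 1 →
      (FermiRG.Salmhofer1998.ModelData.mk 1 (fun p : Fin 2 → ℝ => sqDispersion p - μ) (fun _ _ => U) (fun _ => U)
        k₀ ε₀ : FermiRG.Salmhofer1998.ModelData 2).Hyp) := by
  obtain ⟨hμ₁, hμ₂⟩ := klfs_xwin_sub hμ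
  have hs2 : (1 : ℝ) < Real.sqrt 2 := by
    rw [show (1 : ℝ) = Real.sqrt 1 by simp]; exact Real.sqrt_lt_sqrt (by norm_num) (by norm_num)
  refine ⟨fun L hL hF δ₀ g₀ G₀ w₀ => klfs_fst4_not_inDispersionClass hμ₁.le hμ₂ L hL hF δ₀ g₀ G₀ w₀,
    ⟨by linarith, fun e₀ => klfs_not_bgmAdmissibleE0 (by linarith) e₀⟩,
    fun hE β => klfs_bgm2006_clause3_fails_at_scale_zero hμ₁.le hμ₂ hE β,
    fun D hD r => klfs_fkt2004_not_hypotheses (by linarith) hμ₂.le D hD r,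
    fun U k₀ hk ε₀ hε₀ hε₁ => klfs_sal98_hyp (by linarith) hμ₂ U hk hε₀ hε₁⟩

/-- **BGM 2003 on the extended window, shell width `e₀ = 0.05`** (`μ ± e₀ ∈ [-0.6225, -0.025] ⊂ (-4, 0)`): §1.2's
`DispersionHyp`, the lattice model class `LatticeModelHyp` (any finitely supported pair potential), and Lemma 3.1 (4.3)
sector counting for the Hubbard band. [folklore] -/
theorem klfs_xwin_bgm2003 {μ : ℝ} (hμ : μ ∈ Icc (-0.5725 : ℝ) (-0.075)) :
    FermiRG.BGM2003.DispersionHyp sqDispersion μ 0.05 (fun θ e => bandFermiRadius (μ + e) θ) ∧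
    (∀ (v : Fin 2 → Fin 2 → Literature.Probability.LatticeModels.Site 2 → ℝ), (∀ σ σ' : Fin 2, (Function.support (v σ σ')).Finite) →
      FermiRG.BGM2003.LatticeModelHyp (fun k => sqDispersion k + 4) (μ + 4) 0.05
        (fun θ e => bandFermiRadius (μ + e) θ) v) ∧
    (∃ c : ℝ, 0 < c ∧ ∀ (n n' : ℕ), n ≤ n' →
      (∀ (L : ℕ) (i₁ : Fin L) (ω₁ : ℕ) (ωt : Fin L → ℕ), 4 ≤ L → ω₁ < sectorCount n' →
          (∀ i, ωt i < sectorCount n) →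
          (Nat.card (FermiRG.BGM2003.sectorStrings (fun ϑ e' => bandFermiRadius (μ + e') ϑ) 0.05 n n' L i₁ ω₁ ωt) : ℝ) ≤
            c ^ L * (2 : ℝ) ^ ((n' - n) * (L - 3))) ∧
      (∀ (i₁ : Fin 2) (ω₁ : ℕ) (ωt : Fin 2 → ℕ), ω₁ < sectorCount n' →
          (∀ i, ωt i < sectorCount n) →
          (Nat.card (FermiRG.BGM2003.sectorStrings (fun ϑ e' => bandFermiRadius (μ + e') ϑ) 0.05 n n' 2 i₁ ω₁ ωt) : ℝ) ≤
            c)) :=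
  ⟨klfs_bgm2003_dispersionHyp (by norm_num) (by linarith [hμ.1]) (by linarith [hμ.2]),
    fun v hv => klfs_bgm2003_latticeModelHyp_of_finite (by norm_num) (by linarith [hμ.1]) (by linarith [hμ.2]) v hv,
    klfs_bgm2003_sectorCounting_hubbard (by norm_num) (by linarith [hμ.1]) (by linarith [hμ.2])⟩

/-- **FST II Theorem 1.1 (two-loop volume, `d = 2`) with ONE constant on the extended window**: `∃ Q ≥ 1`,
`𝓦(ε') ≤ Q ε' |log ε'|` for all `μ ∈ [-0.5725, -0.075]`, `0 < ε' ≤ 1/2`. [folklore] -/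
theorem klfs_xwin_volW_le :
    ∃ Q : ℝ, 1 ≤ Q ∧ ∀ μ ∈ Icc (-0.5725 : ℝ) (-0.075), ∀ ε' : ℝ, 0 < ε' → ε' ≤ 1 / 2 →
      FermiRG.volW (FermiRG.Crystal.cubic 2) (fun q : Momentum => squareDispersion 1 0 q - μ) ε' ≤
        ENNReal.ofReal (Q * ε' * |Real.log ε'|) :=
  kltl_exists_volW_le (by norm_num) (by norm_num) (by norm_num)

end Summit.HubbardSuperconductivity.HubbardSuperconductivity.Theorems

end
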